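import Literature.Analysis.SegalBargmann.SchwartzHeisenbergModel
import HarnessLib

/-!
# The unitary group inside the real symplectic group: `realifySp : U(σ) →* Sp(ℝ^σ × ℝ^σ)`, and compact covariance in MVW's language (Folland 1989, Prop. (4.39); MVW Chap. 2 II.1)

Topic `Analysis/SegalBargmann`; namespace `Literature.Analysis.SegalBargmann`.  The tree's compact-group rigidity files
(T4 `SchrodingerCompactRigidity`, T1 `FockDualPairCompact`, T6–T8) are stated over `ι : H → U(σ)` acting on phase space
through `realify (ι h)` (T9).  The archimedean Weil-representation term is typed (W2-∞ (γ)) through MVW's group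
`MpPsi (schwartzSchrodinger σ) ≤ Sp × GL(𝓢)` of T12.  This file supplies the missing homomorphism between the two
languages and the resulting corollaries:

* §1 `phasePt` bookkeeping: additivity, real homogeneity, and the identity
  `Im (conj(p + iq) · (p′ + iq′)) = p·q′ − p′·q` (`im_star_phasePt_dotProduct`): the standard symplectic form of
  `ℝ^σ × ℝ^σ` (`alt (polar (dotPairing σ))`) is the imaginary part of the hermitian form of `ℂ^σ`;
* §2 **`realifyLin U : (ℝ^σ × ℝ^σ) ≃ₗ[ℝ] (ℝ^σ × ℝ^σ)`** with `⇑(realifyLin U) = realify U`, and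
  **`realifySp : Matrix.unitaryGroup σ ℂ →* symplecticGroup (polar (dotPairing σ))`** (`coe_realifySp : ⇑(realifySp U).1 = realify U`):
  unitary matrices preserve the hermitian form, hence its imaginary part (PROVED: `star_mulVec_dotProduct_mulVec`);
* §3 corollaries: `Implements (schwartzSchrodinger σ) (ofSymplectic (realifySp U)) M ↔ ∀ p q f, M (rhoS p q f) = rhoS (realify U (p,q))… (M f)`
  (`implements_realifySp_iff`); for families `(∀ h, Implements … (ofSymplectic (realifySp (ι h))) (ωS h)) ↔ IsRhoCovariantS ι ωS`
  (`implements_realifySp_family_iff`); and the **compact normal form in MVW's language**: such a family with unitary lifts `ω`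
  satisfies `toL2 (ωS h f) = vacCoeff ω h • schrodingerU (ι h) (toL2 f)` (`implements_toL2_apply_of_realifySp`) — so on
  `K × K′` (through T1's `dualPairι`) the term is Folland's metaplectic action up to the vacuum character, with no input
  beyond condition (A) and unitarity.

Everything is PROVED; no cited statement is used as a hypothesis.

## References

* [Folland1989] G. B. Folland, *Harmonic Analysis in Phase Space*, Princeton University Press, 1989, Prop. (4.39)
  (`U(n) ⊂ Sp(n,ℝ)` and its metaplectic action), §4.2 (4.23).
* [MoeglinVignerasWaldspurger1987] C. Mœglin, M.-F. Vignéras, J.-L. Waldspurger, *Correspondances de Howe sur un corps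
  p-adique*, LNM 1291, Chap. 2 II.1 (A).
-/

noncomputable section

open MeasureTheory Complex SchwartzMap Matrix
open scoped InnerProductSpace ComplexConjugate Real FourierTransform

namespace Literature.Analysis.SegalBargmann

open Literature.RepresentationTheory.HeisenbergGroup

variable (σ : Type*) [Fintype σ] [DecidableEq σ]

local notation "L2R" σ => Lp ℂ 2 (volume : Measure (σ → ℝ))
local notation "SR" σ => SchwartzMap (σ → ℝ) ℂ
local notation "PV" σ => (σ → ℝ) × (σ → ℝ)

/-! ## 1. Phase-space bookkeeping -/

omit [Fintype σ] [DecidableEq σ] in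
/-- `phasePt` is real-homogeneous: `phasePt (c•p) (c•q) = c • phasePt p q`. [folklore] -/
theorem phasePt_smul (c : ℝ) (p q : σ → ℝ) : phasePt (c • p) (c • q) = (c : ℂ) • phasePt p q := by
  funext k
  simp only [phasePt_apply, Pi.smul_apply, smul_eq_mul, Complex.ofReal_mul]
  ring

omit [Fintype σ] [DecidableEq σ] in
/-- `phasePt` of a pair, components named. [folklore] -/
theorem phasePt_re (p q : σ → ℝ) (k : σ) : (phasePt p q k).re = p k := by
  simp [phasePt_apply]

omit [Fintype σ] [DecidableEq σ] in
/-- `phasePt` of a pair, components named. [folklore] -/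
theorem phasePt_im (p q : σ → ℝ) (k : σ) : (phasePt p q k).im = q k := by
  simp [phasePt_apply]

omit [DecidableEq σ] in
/-- **The symplectic form is the imaginary part of the hermitian form**:
`Im Σ_k conj(p_k + i q_k)(p′_k + i q′_k) = p·q′ − p′·q`. [cite: Folland1989, Prop. (4.39)] -/
theorem im_star_phasePt_dotProduct (p q p' q' : σ → ℝ) :
    (star (phasePt p q) ⬝ᵥ phasePt p' q').im = p ⬝ᵥ q' - p' ⬝ᵥ q := by
  simp only [dotProduct, Pi.star_apply, phasePt_apply, Complex.im_sum, Complex.star_def, map_add, Complex.conj_ofReal,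
    map_mul, Complex.conj_I]
  rw [← Finset.sum_sub_distrib]
  refine Finset.sum_congr rfl fun k _ => ?_
  simp only [Complex.mul_im, Complex.add_re, Complex.add_im, Complex.ofReal_re, Complex.ofReal_im, Complex.mul_re,
    Complex.I_re, Complex.I_im, Complex.neg_re, Complex.neg_im]
  ring

/-- **Unitary matrices preserve the hermitian form**: `conj(Uz)·(Uz′) = conj(z)·z′`. [cite: Folland1989, Prop. (4.39)] -/
theorem star_mulVec_dotProduct_mulVec (U : Matrix.unitaryGroup σ ℂ) (z z' : σ → ℂ) :
    star ((U : Matrix σ σ ℂ) *ᵥ z) ⬝ᵥ ((U : Matrix σ σ ℂ) *ᵥ z') = star z ⬝ᵥ z' := by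
  rw [star_mulVec, ← dotProduct_mulVec, mulVec_mulVec, ← star_eq_conjTranspose, Matrix.UnitaryGroup.star_mul_self,
    one_mulVec]

/-! ## 2. `realify U` as an element of the symplectic group -/

/-- `realify U` is additive. [folklore] -/
theorem realify_add (U : Matrix.unitaryGroup σ ℂ) (w w' : PV σ) : realify U (w + w') = realify U w + realify U w' := by
  have h : phasePt (w + w').1 (w + w').2 = phasePt w.1 w.2 + phasePt w'.1 w'.2 := by
    rw [Prod.fst_add, Prod.snd_add, phasePt_add]
  ext k
  · show (((U : Matrix σ σ ℂ) *ᵥ phasePt (w + w').1 (w + w').2) k).re = _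
    rw [h, mulVec_add]
    rfl
  · show (((U : Matrix σ σ ℂ) *ᵥ phasePt (w + w').1 (w + w').2) k).im = _
    rw [h, mulVec_add]
    rfl

/-- `realify U` is real-homogeneous. [folklore] -/
theorem realify_smul (U : Matrix.unitaryGroup σ ℂ) (c : ℝ) (w : PV σ) : realify U (c • w) = c • realify U w := by
  have h : phasePt (c • w).1 (c • w).2 = (c : ℂ) • phasePt w.1 w.2 := by
    rw [Prod.smul_fst, Prod.smul_snd, phasePt_smul]
  ext k
  · show (((U : Matrix σ σ ℂ) *ᵥ phasePt (c • w).1 (c • w).2) k).re = c * (((U : Matrix σ σ ℂ) *ᵥ phasePt w.1 w.2) k).re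
    rw [h, mulVec_smul, Pi.smul_apply, smul_eq_mul, Complex.re_ofReal_mul]
  · show (((U : Matrix σ σ ℂ) *ᵥ phasePt (c • w).1 (c • w).2) k).im = c * (((U : Matrix σ σ ℂ) *ᵥ phasePt w.1 w.2) k).im
    rw [h, mulVec_smul, Pi.smul_apply, smul_eq_mul, Complex.im_ofReal_mul]

omit [Fintype σ] [DecidableEq σ] in
/-- A pair is determined by its `phasePt`. [folklore] -/
theorem pv_ext {a b : PV σ} (h : phasePt a.1 a.2 = phasePt b.1 b.2) : a = b :=
  Prod.ext (eq_of_phasePt_eq h).1 (eq_of_phasePt_eq h).2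

/-- `realify` is multiplicative: `realify (U U′) = realify U ∘ realify U′`. [folklore] -/
theorem realify_mul (U U' : Matrix.unitaryGroup σ ℂ) (w : PV σ) : realify (U * U') w = realify U (realify U' w) := by
  apply pv_ext
  rw [phasePt_realify, phasePt_realify, phasePt_realify, mulVec_mulVec]
  rfl

/-- `realify 1 = id`. [folklore] -/
theorem realify_one (w : PV σ) : realify (1 : Matrix.unitaryGroup σ ℂ) w = w := by
  apply pv_ext
  rw [phasePt_realify]
  show (1 : Matrix σ σ ℂ) *ᵥ phasePt w.1 w.2 = phasePt w.1 w.2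
  rw [one_mulVec]

/-- **`realify U` as a real-linear automorphism of phase space.** [cite: Folland1989, Prop. (4.39)] -/
def realifyLin (U : Matrix.unitaryGroup σ ℂ) : (PV σ) ≃ₗ[ℝ] PV σ where
  toFun := realify U
  invFun := realify U⁻¹
  map_add' := realify_add σ U
  map_smul' := realify_smul σ U
  left_inv w := by rw [← realify_mul, inv_mul_cancel, realify_one]
  right_inv w := by rw [← realify_mul, mul_inv_cancel, realify_one]

/-- Unfolding. [folklore] -/
@[simp] theorem coe_realifyLin (U : Matrix.unitaryGroup σ ℂ) : ⇑(realifyLin σ U) = realify U := rfl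

/-- **`realify U` is symplectic**: it preserves `p·q′ − p′·q`. [cite: Folland1989, Prop. (4.39)] -/
theorem realifyLin_mem_symplecticGroup (U : Matrix.unitaryGroup σ ℂ) :
    realifyLin σ U ∈ symplecticGroup (polar (dotPairing σ)) := by
  rw [mem_symplecticGroup]
  intro w w'
  simp only [polar_apply, dotPairing_apply, coe_realifyLin]
  rw [← im_star_phasePt_dotProduct, ← im_star_phasePt_dotProduct, phasePt_realify, phasePt_realify,
    star_mulVec_dotProduct_mulVec]

/-- **The unitary group in the symplectic group**: `realifySp : U(σ) →* Sp(ℝ^σ × ℝ^σ)`. [cite: Folland1989, Prop. (4.39)] -/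
def realifySp : Matrix.unitaryGroup σ ℂ →* symplecticGroup (polar (dotPairing σ)) where
  toFun U := ⟨realifyLin σ U, realifyLin_mem_symplecticGroup σ U⟩
  map_one' := by
    apply Subtype.ext
    apply LinearEquiv.ext
    intro w
    exact realify_one σ w
  map_mul' U U' := by
    apply Subtype.ext
    apply LinearEquiv.ext
    intro w
    show realify (U * U') w = realify U (realify U' w)
    exact realify_mul σ U U' w

/-- Unfolding: the underlying map of `realifySp U` is `realify U`. [folklore] -/
@[simp] theorem coe_realifySp (U : Matrix.unitaryGroup σ ℂ) :
    ⇑((realifySp σ U).1 : (PV σ) ≃ₗ[ℝ] PV σ) = realify U := rfl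

/-! ## 3. Compact covariance in MVW's language -/

/-- Condition (A) at a unitary `U`, through `realifySp`, is `rhoS`-covariance over `realify U`.
[cite: MoeglinVignerasWaldspurger1987, Chap. 2 II.1 (A)] -/
theorem implements_realifySp_iff (U : Matrix.unitaryGroup σ ℂ) (M : (SR σ) ≃ₗ[ℂ] SR σ) :
    Implements (schwartzSchrodinger σ) (ofSymplectic _ (realifySp σ U)) M ↔
      ∀ (p q : σ → ℝ) (f : SR σ), M (rhoS p q f) = rhoS (realify U (p, q)).1 (realify U (p, q)).2 (M f) :=
  implements_ofSymplectic_iff σ (realifySp σ U) M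

variable {H : Type*}

/-- **Family version**: condition (A) over `realifySp ∘ ι` is `IsRhoCovariantS ι`. [cite: MoeglinVignerasWaldspurger1987, Chap. 2 II.1 (A)] -/
theorem implements_realifySp_family_iff (ι : H → Matrix.unitaryGroup σ ℂ) (ωS : H → ((SR σ) ≃ₗ[ℂ] SR σ)) :
    (∀ h, Implements (schwartzSchrodinger σ) (ofSymplectic _ (realifySp σ (ι h))) (ωS h)) ↔
      IsRhoCovariantS ι (fun h => ((ωS h : (SR σ) ≃ₗ[ℂ] SR σ) : (SR σ) →ₗ[ℂ] SR σ)) :=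
  implements_family_iff σ (fun h => realifySp σ (ι h)) ωS

/-- **Compact normal form in MVW's language**: a family satisfying (A) over `realifySp ∘ ι` whose members restrict
unitaries `ω h` of `L²` acts, inside `L²`, by `vacCoeff ω h • μ₀(ι h)`. [cite: Folland1989, Prop. (4.39)] -/
theorem implements_toL2_apply_of_realifySp {ι : H → Matrix.unitaryGroup σ ℂ} {ωS : H → ((SR σ) ≃ₗ[ℂ] SR σ)}
    {ω : H → ((L2R σ) ≃ₗᵢ[ℂ] L2R σ)}
    (hA : ∀ h, Implements (schwartzSchrodinger σ) (ofSymplectic _ (realifySp σ (ι h))) (ωS h))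
    (hlift : ∀ h, LiftsTo ((ωS h : (SR σ) ≃ₗ[ℂ] SR σ) : (SR σ) →ₗ[ℂ] SR σ) (liftCLM ω h)) (h : H) (f : SR σ) :
    toL2 (ωS h f) = vacCoeff ω h • schrodingerU (ι h) (toL2 f) :=
  IsRhoCovariantS.toL2_apply ((implements_realifySp_family_iff σ ι ωS).1 hA) hlift h f

/-- The lifts of such a family are `IsRhoCovariant` (so T4/T1/T6–T8 apply to them verbatim). [cite: Folland1989, Prop. (4.39)] -/
theorem implements_isRhoCovariant_of_realifySp {ι : H → Matrix.unitaryGroup σ ℂ} {ωS : H → ((SR σ) ≃ₗ[ℂ] SR σ)}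
    {ω : H → ((L2R σ) ≃ₗᵢ[ℂ] L2R σ)}
    (hA : ∀ h, Implements (schwartzSchrodinger σ) (ofSymplectic _ (realifySp σ (ι h))) (ωS h))
    (hlift : ∀ h, LiftsTo ((ωS h : (SR σ) ≃ₗ[ℂ] SR σ) : (SR σ) →ₗ[ℂ] SR σ) (liftCLM ω h)) :
    IsRhoCovariant ι ω :=
  IsRhoCovariantS.lift ((implements_realifySp_family_iff σ ι ωS).1 hA) hlift

end Literature.Analysis.SegalBargmann
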